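import Summits.CriticalPhenomena.PercolationContinuityZ3.Theorems.Transplant.KNCells2ThetaPosChosen
import HarnessLib

/-!
# F8 (generic, lag-1 anchors) with the UNIT-INCREMENT anchor rule (`A = ℕ`, `anchor a _ _ = a + 1`, `a₀ = 0` — the concentric `X □ ℤ²`
# geometry `cellGeomCG`): anchors are DEPTHS — `dep = arr + 1` off the root, depth-`1` vertices are the root's lattice neighbours, the root
# is always occupied and never a target; the chosen-edge corollaries that p3-g2's schedule lemmas (`ConcScheduleG.rE_eq` / `ρ_eq`) consume

builds on p205010 (kernel theorem, internal audit signed; external expert review pending) — nothing in this file uses p205010.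
Lane `prim-bschramm`, seat `prim-bschramm-p5` (gen 3, refuter; follow-up to the chosen-edge interface p221346/p221640 and to the anchor
bookkeeping note of 14:30Z), helper file (`--supports stmt-CriticalPhenomena-4575`).

For a chosen edge `e` after any history (`(S.astOf₂ G h).st.choice = some e`):
* `anchors_of_choice_succ` — `β = α + 1`, or `e.1 = 0` with `α = β = 0`;
* `src_eq_step_of_dep_one` — if `β = 1` then the source is a lattice neighbour of the root: `e.1 = tgt (0, d)` for some `d`;
* `zero_mem_occ_astOf₂`, `tgt_ne_zero_of_choice` — the root stays occupied, so a chosen target is never the root cell.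
Hence at anchor `0` the three planar generations of the schedule are told apart by position exactly as `KNCellsBoxProdZ2ConcScheduleG`
assumes (`nQ 0 w = min ‖w‖₁ 2`): `(α,β) = (0,0)` ⇒ examined cell `= stepVec e.2` (generation 1); `(α,β) = (0,1)` ⇒ examined cell
`= stepVec d + stepVec e.2 ≠ 0` (generation 2); `α ≥ 1` ⇒ position-free.
[cite: KozmaNitzan2024, §4 pp. 25–27 (the exploration process; X_1 = G_1 = {0})]
-/

noncomputable section

open scoped Classical

namespace Summit.CriticalPhenomena.PercolationContinuityZ3.Theorems

namespace Transplant

namespace KNCells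

open Literature.Probability.Percolation Literature.Probability.LatticeModels SimpleGraph GadgetSystem ProbeHistory HSiteScheme Contour

namespace KSchA

variable {V : Type*} [DecidableEq V] {G : SimpleGraph V} [G.LocallyFinite] {S : KSchA V ℕ}

/-- **Unit-increment anchors are depths**: after any history every macro-vertex has `dep = arr + 1`, or both anchors `0` and it is occupied
only if it is the root. [folklore] -/
theorem anchors_replay_succ (hanch : ∀ a v P, S.Γ.anchor a v P = a + 1) (h0 : S.Γ.a₀ = 0) (h : ProbeHistory V) (v : Site 2) :
    (S.astOf₂ G h).dep v = (S.astOf₂ G h).arr v + 1 ∨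
      ((S.astOf₂ G h).arr v = 0 ∧ (S.astOf₂ G h).dep v = 0 ∧ (v ∈ (S.astOf₂ G h).st.occ → v = 0)) := by
  rcases anchors_replay (S := S) (G := G) h v with ⟨P, hP⟩ | ⟨h1, h2, h3⟩
  · exact Or.inl (by rw [hP, hanch])
  · exact Or.inr ⟨by rw [h1, h0], by rw [h2, h0], h3⟩

/-- **Anchors of a chosen edge, unit-increment rule**: `β = α + 1`, or the source is the root with `α = β = 0`. [folklore] -/
theorem anchors_of_choice_succ (hanch : ∀ a v P, S.Γ.anchor a v P = a + 1) (h0 : S.Γ.a₀ = 0) (h : ProbeHistory V)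
    {e : Site 2 × MDir} (hc : (S.astOf₂ G h).st.choice = some e) :
    S.aOf₂ G h e = S.aOf₁ G h e + 1 ∨ (e.1 = 0 ∧ S.aOf₁ G h e = 0 ∧ S.aOf₂ G h e = 0) := by
  rcases anchors_replay_succ (S := S) (G := G) hanch h0 h e.1 with h1 | ⟨h1, h2, h3⟩
  · exact Or.inl h1
  · exact Or.inr ⟨h3 (HState.cand_of_choice hc).1, h1, h2⟩

/-- **The root stays occupied** along the replay of any history. [cite: KozmaNitzan2024, §4 p. 25 (G_1 = {0})] -/
theorem zero_mem_occ_astOf₂ : ∀ h : ProbeHistory V, (0 : Site 2) ∈ (S.astOf₂ G h).st.occ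
  | [] => by simp [astOf₂_nil, HState.start]
  | none :: h => by rw [astOf₂_cons_none]; exact zero_mem_occ_astOf₂ h
  | some r :: h => by
    rw [astOf₂_cons_some]
    cases hc : (S.astOf₂ G h).st.choice with
    | none => exact zero_mem_occ_astOf₂ h
    | some e =>
      dsimp only
      exact HState.occ_subset_update _ _ _ (zero_mem_occ_astOf₂ h)

/-- **A chosen target is never the root cell** (the root is occupied, hence determined, and candidates have undetermined targets). [folklore] -/
theorem tgt_ne_zero_of_choice (h : ProbeHistory V) {e : Site 2 × MDir} (hc : (S.astOf₂ G h).st.choice = some e) : tgt e ≠ 0 := by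
  intro ht
  have hdet : (S.astOf₂ G h).st.Det (tgt e) := by rw [ht]; exact Or.inl (zero_mem_occ_astOf₂ (S := S) (G := G) h)
  exact (HState.cand_of_choice hc).2 hdet

/-- **Depth-one vertices are lattice neighbours of the root** (unit-increment rule): if `dep v = 1` after some history then `v = tgt (0, d)` for
some direction `d` — because `v` was a target examined from a source of depth `0`, and the only occupied vertex of depth `0` is the root. [folklore] -/
theorem eq_step_of_dep_one (hanch : ∀ a v P, S.Γ.anchor a v P = a + 1) (h0 : S.Γ.a₀ = 0) :
    ∀ (h : ProbeHistory V) (v : Site 2), (S.astOf₂ G h).dep v = 1 → ∃ d : MDir, v = tgt ((0 : Site 2), d)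
  | [], v, hv => by
    exfalso
    have : (S.astOf₂ G []).dep v = 0 := by simp [astOf₂_nil, h0]
    omega
  | none :: h, v, hv => by
    rw [astOf₂_cons_none] at hv
    exact eq_step_of_dep_one hanch h0 h v hv
  | some r :: h, v, hv => by
    rw [astOf₂_cons_some] at hv
    cases hc : (S.astOf₂ G h).st.choice with
    | none =>
      rw [hc] at hv
      exact eq_step_of_dep_one hanch h0 h v hv
    | some e =>
      rw [hc] at hv
      dsimp only at hv
      by_cases hve : v = tgt e
      · subst hve
        simp only [Function.update_self, depB, hanch] at hv
        -- the source has depth 0, and it is occupied: it is the root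
        have hdep0 : (S.astOf₂ G h).dep e.1 = 0 := by omega
        have he0 : e.1 = 0 := by
          rcases anchors_replay_succ (S := S) (G := G) hanch h0 h e.1 with h1 | ⟨-, -, h3⟩
          · omega
          · exact h3 (HState.cand_of_choice hc).1
        refine ⟨e.2, ?_⟩
        obtain ⟨e1, e2⟩ := e
        simp only at he0
        subst he0
        rfl
      · rw [Function.update_of_ne hve] at hv
        exact eq_step_of_dep_one hanch h0 h v hv

/-- **Source of a chosen edge with stub anchor `1`** is a lattice neighbour of the root (so the examined cell `tgt e = tgt (0,d) + stepVec e.2`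
is a planar generation-`2` cell, being `≠ 0` by `tgt_ne_zero_of_choice`). [folklore] -/
theorem src_eq_step_of_choice_dep_one (hanch : ∀ a v P, S.Γ.anchor a v P = a + 1) (h0 : S.Γ.a₀ = 0) (h : ProbeHistory V)
    {e : Site 2 × MDir} (h1 : S.aOf₂ G h e = 1) : ∃ d : MDir, e.1 = tgt ((0 : Site 2), d) :=
  eq_step_of_dep_one hanch h0 h e.1 h1

/-- **Source of a chosen edge with stub anchor `0`** is the root (so the examined cell is `tgt (0, e.2) = stepVec e.2`, generation `1`). [folklore] -/
theorem src_eq_zero_of_choice_dep_zero (hanch : ∀ a v P, S.Γ.anchor a v P = a + 1) (h0 : S.Γ.a₀ = 0) (h : ProbeHistory V)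
    {e : Site 2 × MDir} (hc : (S.astOf₂ G h).st.choice = some e) (hβ : S.aOf₂ G h e = 0) : e.1 = 0 := by
  rcases anchors_of_choice_succ (S := S) (G := G) hanch h0 h hc with h1 | ⟨h1, -, -⟩
  · rw [hβ] at h1; omega
  · exact h1

end KSchA

end KNCells

end Transplant

end Summit.CriticalPhenomena.PercolationContinuityZ3.Theorems

end
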